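import Summits.PneNP.PneNP.Theorems.CliqueExtLowerBound.Negative.AnchoredThetaExitPos
import Summits.PneNP.PneNP.Theorems.CliqueExtLowerBound.Negative.AnchoredThetaExitNeg
import Summits.PneNP.PneNP.Theorems.CliqueExtLowerBound.Negative.AnchoredThetaNumerics

/-!
# `stub_convReplaceable` of line `width-threshold-certificate-sparsity` is FALSE (crux stmt-PneNP-10682)

Negative lemma for the crux `Summit.PneNP.PneNP.Theses.ConvexRankGates.CliqueExtLowerBound`
(item stmt-PneNP-10682), line `width-threshold-certificate-sparsity`
(`Cruxes/CliqueExtLowerBound/Lines/width-threshold-certificate-sparsity.lean`): its hardest stub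
`stub_convReplaceable : ConvReplaceableStatement` ("every CONV gate of width `≤ m^c` is REPLACEABLE,
on the referee push-forwards through local children, by a monotone `{∧,∨,0,1}`-circuit of size
`m^a`, `a = a(c)`") is refuted: `stub_convReplaceable_false : ¬ <registered stub signature>`.

THE WITNESS (the anchored Lovász theta gate). At `c = 3`, for EVERY `a`, localities `r = 3`,
`s = 4`, and every large `m = n + 2`: anchor edge `e₀ = {n+1, 0}`; derived vertices `Fin (n+1)`
(all but the anchor vertex); gate `φ = thetaGate (n+1) (k-1)`, the theta programme on the derived
vertices with clique parameter `k - 1` (`k = ⌈m^{1/4}⌉₊`), a CONV gate of description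
`4(n+1)² + 4 ≤ m³`; positive children `d_j = {{e₀, p_j}}`, negative children
`c_j = {{e₀, f(α,γ), f(β,γ)} : γ < h}` with private class edges `f(α,γ) = {α, α+γ+1}` and
`h = D⌊√D⌋`, `D = ⌊m^{1/8}⌋₊`. On an anchored positive (a `k`-clique through `e₀`) the gate sees the
clique vector of a `(k-1)`-clique and ACCEPTS; on an anchored negative (`e₀ ∈ M`) all of whose
vertices carry a class it sees a vector below a `h`-colouring vector and REJECTS. Jukna's criterion
(`Circuit.lowerBoundsCriterion`, tree) run on the DERIVED coordinates of a putative replacement `Ψ`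
of size `≤ m^a` has both exits absurd: (ii) `Ψ ≤ ⋁_{j∈I} x_j ∨ (exact r'-DNF)` rejects almost every
anchored clique although (V1) lets it reject only `ε C(m,k)` of the `C(n,k-2)` of them; (i)
`(exact s'-CNF) ≤ Ψ` accepts almost every classified anchored negative although the gate rejects
them and (V2) allows only `ε C(N,t)` such acceptances. (The same `(φ, d, c)` IS sandwichable in the
line's engine currency — `Replaceable` is strictly stronger than what `core` consumes; see the
refuter note `NegativeNote-stub_convReplaceable.md` in the crux folder.)

Sections: A the theta gate as ONE CONV gate (adapted from the landed
`ConvexRankGatesThetaGateKillsRazborovPair`, whose matrix lemmas are reused); B counting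
(supersets among `k`-subsets, binomial ratios); C the anchored instance and the values of the
children; D helper facts (span lemma, incidences of a class assignment, the sum over class
assignments); E the two finite exits (`casePos_absurd`, `caseNeg_absurd`); F asymptotics of
`k = ⌈m^{1/4}⌉₊`, `D = ⌊m^{1/8}⌋₊`; G the numeric budgets; H `params_ok` and the refutation.

-/

set_option linter.dupNamespace false

namespace Summit.PneNP.PneNP.Theorems.CliqueExtLowerBound.Negative

open Literature.Computability.Complexity Literature.Combinatorics.SimpleGraph Matrix Finset Filter

noncomputable section

/-! ## H. The refutation of the registered stub -/

section Main

/-- Pure arithmetic: every side condition of the two finite exits follows from the base facts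
`m ≤ k⁴ ≤ 16 m`, `D⁸ ≤ m`, `1 ≤ D` and explicit polynomial thresholds on `m = n + 2`. -/
theorem params_ok (n a S k Dm NN t : ℕ) (h16 : 16 ≤ n + 2)
    (hT1 : (64 * S + 4 * a + 40) ^ 4 ≤ n + 2) (hT4 : 4 * S + 6 ≤ n + 2)
    (hkm : n + 2 ≤ k ^ 4) (hk16 : k ^ 4 ≤ 16 * (n + 2))
    (hD8 : Dm ^ 8 ≤ n + 2) (hD1 : 1 ≤ Dm)
    (hNN : NN = (n + 2).choose 2) (ht : t = NN / Dm) :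
    (3 ≤ k ∧ 4 * a + 6 ≤ k ∧ k ≤ n + 2 ∧ 4 * (S - 1) * k ≤ n) ∧
    (Dm ≤ n + 2 ∧ 1 ≤ Dm * Nat.sqrt Dm ∧ 2 * (Dm * Nat.sqrt Dm) ≤ n ∧
      Dm * Nat.sqrt Dm < k - 1 ∧ (Dm * Nat.sqrt Dm) ^ 2 ≤ Dm ^ 3) ∧
    (4 * Dm ≤ NN ∧ NN < Dm * (t + 1) ∧ 2 * S + 2 ≤ t ∧ t ≤ NN ∧ (t - 1) * Dm ≤ NN - 1 ∧
      Dm * Nat.sqrt Dm ≤ NN - 1) := by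
  set q : ℕ := Nat.sqrt Dm with hq
  -- k
  have hK0 : 64 * S + 4 * a + 40 ≤ k :=
    (Nat.pow_le_pow_iff_left (by norm_num : (4 : ℕ) ≠ 0)).1 (hT1.trans hkm)
  have hk3 : 3 ≤ k := by omega
  have hkn : k ≤ n + 2 := by
    have h1 : 16 * k ≤ k ^ 4 := by
      have : 16 ≤ k ^ 3 := le_trans (by norm_num : 16 ≤ 3 ^ 3) (Nat.pow_le_pow_left hk3 3)
      calc 16 * k ≤ k ^ 3 * k := Nat.mul_le_mul_right k this
        _ = k ^ 4 := by ring
    omega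
  have h4sk : 4 * (S - 1) * k ≤ n := by
    have h1 : 16 * (4 * S * k + 2) ≤ (64 * S + 32) * k := by
      have e1 : 16 * (4 * S * k + 2) = 64 * (S * k) + 32 := by ring
      have e2 : (64 * S + 32) * k = 64 * (S * k) + 32 * k := by ring
      omega
    have h2 : (64 * S + 32) * k ≤ k * k := Nat.mul_le_mul_right k (by omega)
    have h3 : k * k ≤ k ^ 4 := by
      calc k * k = k ^ 2 := (sq k).symm
        _ ≤ k ^ 4 := Nat.pow_le_pow_right (by omega) (by norm_num)
    have h4 : 4 * (S - 1) * k ≤ 4 * S * k := Nat.mul_le_mul_right k (by omega)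
    omega
  -- D, q, h
  have hDm_le : Dm ≤ n + 2 := le_trans (Nat.le_self_pow (by norm_num) Dm) hD8
  have hDsq_k : Dm * Dm ≤ k := by
    have : (Dm * Dm) ^ 4 ≤ k ^ 4 := by
      calc (Dm * Dm) ^ 4 = Dm ^ 8 := by ring
        _ ≤ n + 2 := hD8
        _ ≤ k ^ 4 := hkm
    exact (Nat.pow_le_pow_iff_left (by norm_num : (4 : ℕ) ≠ 0)).1 this
  have hq1 : 1 ≤ q := Nat.le_sqrt.2 (by omega)
  have hqD : q * q ≤ Dm := Nat.sqrt_le Dm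
  have hq_le : q ≤ Dm := Nat.sqrt_le_self Dm
  have hh1 : 1 ≤ Dm * q := Nat.mul_le_mul hD1 hq1
  have hh_sq : (Dm * q) ^ 2 ≤ Dm ^ 3 := by
    calc (Dm * q) ^ 2 = Dm ^ 2 * (q * q) := by ring
      _ ≤ Dm ^ 2 * Dm := Nat.mul_le_mul_left _ hqD
      _ = Dm ^ 3 := by ring
  have hh_le : Dm * q ≤ Dm * Dm := Nat.mul_le_mul_left _ hq_le
  have hDD8 : Dm * Dm ≤ n + 2 := by
    calc Dm * Dm = Dm ^ 2 := (sq Dm).symm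
      _ ≤ Dm ^ 8 := Nat.pow_le_pow_right hD1 (by norm_num)
      _ ≤ n + 2 := hD8
  have hh2 : 2 * (Dm * q) ≤ n := by
    rcases Nat.lt_or_ge Dm 2 with hlt | hge
    · have hD : Dm = 1 := by omega
      have h1 : Dm * q ≤ 1 := by rw [hD] at hh_le ⊢; simpa using hh_le
      omega
    · have h6 : 64 ≤ Dm ^ 6 := le_trans (by norm_num : 64 ≤ 2 ^ 6) (Nat.pow_le_pow_left hge 6)
      have h7 : 64 * (Dm * Dm) ≤ n + 2 := by
        calc 64 * (Dm * Dm) ≤ Dm ^ 6 * (Dm * Dm) := Nat.mul_le_mul_right _ h6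
          _ = Dm ^ 8 := by ring
          _ ≤ n + 2 := hD8
      omega
  have hhk : Dm * q < k - 1 := by
    rcases Nat.lt_or_ge Dm 4 with hlt | hge
    · have hq1' : q ≤ 1 := by
        rcases Nat.lt_or_ge q 2 with h2 | h2
        · omega
        · have := Nat.mul_le_mul h2 h2; omega
      have : Dm * q ≤ 3 := by
        calc Dm * q ≤ 3 * 1 := Nat.mul_le_mul (by omega) hq1'
          _ = 3 := by norm_num
      omega
    · have hq2 : 2 ≤ q := Nat.le_sqrt.2 (by omega)
      have h2q : 2 * q ≤ Dm := le_trans (Nat.mul_le_mul_right q hq2) hqD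
      have : 2 * (Dm * q) ≤ Dm * Dm := by
        calc 2 * (Dm * q) = Dm * (2 * q) := by ring
          _ ≤ Dm * Dm := Nat.mul_le_mul_left _ h2q
      omega
  -- NN, t
  have hNN2 : NN * 2 = (n + 2) * (n + 1) := by
    have h := Nat.add_one_mul_choose_eq (n + 1) 1
    simp only [Nat.choose_one_right, show n + 1 + 1 = n + 2 from rfl, show 1 + 1 = 2 from rfl] at h
    rw [hNN]
    linarith
  have h4D : 4 * Dm ≤ NN := by
    have h1 : (n + 2) * 8 ≤ (n + 2) * (n + 1) := Nat.mul_le_mul_left _ (by omega)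
    omega
  have hDt : t * Dm ≤ NN := by rw [ht]; exact Nat.div_mul_le_self NN Dm
  have htD' : NN < Dm * (t + 1) := by
    have h1 := Nat.div_add_mod NN Dm
    have h2 := Nat.mod_lt NN (show 0 < Dm by omega)
    have h3 : Dm * (NN / Dm + 1) = Dm * (NN / Dm) + Dm := by ring
    rw [ht, h3]
    omega
  have hts : 2 * S + 2 ≤ t := by
    rw [ht, Nat.le_div_iff_mul_le (by omega)]
    calc (2 * S + 2) * Dm ≤ (2 * S + 2) * (n + 2) := Nat.mul_le_mul_left _ hDm_le
      _ ≤ NN := by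
          refine Nat.le_of_mul_le_mul_right ?_ (by norm_num : 0 < 2)
          calc (2 * S + 2) * (n + 2) * 2 = (n + 2) * (2 * (2 * S + 2)) := by ring
            _ ≤ (n + 2) * (n + 1) := Nat.mul_le_mul_left _ (by omega)
            _ = NN * 2 := hNN2.symm
  have htN : t ≤ NN := by rw [ht]; exact Nat.div_le_self NN Dm
  have htD : (t - 1) * Dm ≤ NN - 1 := by
    have e := Nat.sub_one_mul t Dm
    have hv : t * Dm ≤ NN := hDt
    have hD : 1 ≤ Dm := hD1
    omega
  have hhN : Dm * q ≤ NN - 1 := by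
    have h1 : Dm * q ≤ n + 2 := hh_le.trans hDD8
    have h2 : (n + 2) * 3 ≤ (n + 2) * (n + 1) := Nat.mul_le_mul_left _ (by omega)
    omega
  exact ⟨⟨hk3, by omega, hkn, h4sk⟩, ⟨hDm_le, hh1, hh2, hhk, hh_sq⟩,
    ⟨h4D, htD', hts, htN, htD, hhN⟩⟩

/-- The theta gate on `n+1` vertices has description `≤ (n+2)³` for `n ≥ 2`. -/
theorem theta_width_le (n : ℕ) (hn : 2 ≤ n) : 4 * (n + 1) ^ 2 + 4 ≤ (n + 2) ^ 3 := by
  nlinarith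

open Classical in
/-- **`stub_convReplaceable` (line `width-threshold-certificate-sparsity` of crux stmt-PneNP-10682,
`ConvReplaceableStatement`) is FALSE.** At `c = 3`, for EVERY size exponent `a` and the localities
`r = 3, s = 4`, at every large `m = n + 2` the anchored theta gate `thetaGate (n+1) (k-1)`
(`k = ⌈m^{1/4}⌉₊`, a CONV gate of description `≤ m³`) with the children `dd n`, `cc n h`
(`h = D ⌊√D⌋`, `D = ⌊m^{1/8}⌋₊`) admits NO monotone `{∧,∨,0,1}`-circuit `Ψ` with `≤ m^a` gates that
accepts all but `ε #posFam` of the positives the gate accepts and rejects all but `ε #negFam` of the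
negatives the gate rejects (`ε = 1/(8 m⁴)`): Jukna's criterion (`Circuit.lowerBoundsCriterion`) run
on the DERIVED coordinates has both exits absurd (`casePos_absurd`, `caseNeg_absurd`). The statement
below is the registered stub signature verbatim. -/
theorem stub_convReplaceable_false :
    ¬ (∀ c : ℕ, ∃ a : ℕ, ∀ r s : ℕ, 2 ≤ r → 2 ≤ s → ∀ᶠ m : ℕ in atTop, ∀ φ : GateFn,
      IsConvGate (m ^ c) φ →
      ∀ (D C : Fin φ.1 → Finset (Finset ((⊤ : SimpleGraph (Fin m)).edgeSet))),
        #(univ.image fun j => (D j, C j)) ≤ m ^ (c + 3) →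
        (∀ j, ∀ R ∈ D j, #R ≤ r - 1) → (∀ j, ∀ S ∈ C j, #S ≤ s - 1) →
        (∀ j x, EvalDNF (D j) x → EvalCNF (C j) x) →
        ∃ Ψ : Circuit (Fin φ.1), Ψ.IsOver monotoneBasis01 ∧ Ψ.size ≤ m ^ a ∧
          (#((posGraphs m ⌈(m : ℝ) ^ (1 / 4 : ℝ)⌉₊).filter (fun x =>
              φ.2 (fun j => decide (EvalDNF (D j) x)) = true ∧
                Ψ.eval (fun j => decide (EvalDNF (D j) x)) = false)) : ℝ) ≤
            (1 / (8 * (m : ℝ) ^ (c + 1))) * #(posGraphs m ⌈(m : ℝ) ^ (1 / 4 : ℝ)⌉₊) ∧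
          (#((((powersetCard (Fintype.card ((⊤ : SimpleGraph (Fin m)).edgeSet) /
              ⌊(m : ℝ) ^ (1 / 8 : ℝ)⌋₊) (univ : Finset ((⊤ : SimpleGraph (Fin m)).edgeSet))).image
                (fun M => fun e => decide (e ∉ M)))).filter (fun x =>
              Ψ.eval (fun j => decide (EvalCNF (C j) x)) = true ∧
                φ.2 (fun j => decide (EvalCNF (C j) x)) = false)) : ℝ) ≤
            (1 / (8 * (m : ℝ) ^ (c + 1))) *
              #(((powersetCard (Fintype.card ((⊤ : SimpleGraph (Fin m)).edgeSet) /
                ⌊(m : ℝ) ^ (1 / 8 : ℝ)⌋₊) (univ : Finset ((⊤ : SimpleGraph (Fin m)).edgeSet))).image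
                  (fun M => fun e => decide (e ∉ M))))) := by
  intro H
  obtain ⟨a, Ha⟩ := H 3
  have Hev := Ha 3 4 (by norm_num) (by norm_num)
  -- explicit thresholds (all eventually true)
  have T0 : ∀ᶠ m : ℕ in atTop, 16 ≤ m := eventually_ge_atTop 16
  have T1 : ∀ᶠ m : ℕ in atTop, (64 * ss a + 4 * a + 40) ^ 4 ≤ m := eventually_ge_atTop _
  have T2 : ∀ᶠ m : ℕ in atTop, 4 * (ss a - 1) ^ rr a * 256 ^ (a + 1) ≤ m := eventually_ge_atTop _
  have T3 : ∀ᶠ m : ℕ in atTop,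
      4 * ((rr a - 1) ^ ss a * ((ss a + 1) * ss a ^ ss a)) * 256 ^ (a + 1) ≤ m :=
    eventually_ge_atTop _
  have T4 : ∀ᶠ m : ℕ in atTop, 4 * ss a + 6 ≤ m := eventually_ge_atTop _
  obtain ⟨m, hmain, h16, hT1, hT2, hT3, hT4, hdec⟩ :=
    (Hev.and (T0.and (T1.and (T2.and (T3.and (T4.and eventually_decay)))))).exists
  -- m = n + 2
  obtain ⟨n, rfl⟩ : ∃ n, m = n + 2 := ⟨m - 2, by omega⟩
  have hm1 : 1 ≤ n + 2 := by omega
  -- base facts about k = ⌈m^{1/4}⌉₊ and D = ⌊m^{1/8}⌋₊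
  obtain ⟨hkm, hk16⟩ := ceil_quarter_bounds (n + 2) hm1
  obtain ⟨hD8, hD8', hD1⟩ := floor_eighth_bounds (n + 2) hm1
  set k : ℕ := ⌈((n + 2 : ℕ) : ℝ) ^ (1 / 4 : ℝ)⌉₊ with hk
  set Dm : ℕ := ⌊((n + 2 : ℕ) : ℝ) ^ (1 / 8 : ℝ)⌋₊ with hDm
  set q : ℕ := Nat.sqrt Dm with hq
  set h : ℕ := Dm * q with hh
  set NN : ℕ := Fintype.card (EV n) with hNNdef
  set t : ℕ := NN / Dm with ht
  obtain ⟨⟨hk3, hk46, hkn, h4sk⟩, ⟨hDm_le, hh1, hh2, hhk, hh_sq⟩, ⟨h4D, htD', hts, htN, htD, hhN⟩⟩ :=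
    params_ok n a (ss a) k Dm NN t h16 hT1 hT4 hkm hk16 hD8 hD1 (card_EV n) rfl
  have hkw : w0 a + 1 ≤ k := by rw [w0_eq]; omega
  have ht1 : 1 ≤ t := by omega
  -- the gate, the children, and the stub's circuit
  have hconv : IsConvGate ((n + 2) ^ 3) (thetaGate (n + 1) (k - 1)) :=
    (thetaGate_isConvGate (n + 1) (k - 1)).mono (theta_width_le n (by omega))
  obtain ⟨Ψ, hΨB, hΨsz, hV1, hV2⟩ := hmain (thetaGate (n + 1) (k - 1)) hconv (dd n) (cc n h)
    ((card_pairs_le n h).trans (Nat.pow_le_pow_right (by omega) (by norm_num)))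
    (dd_local n) (cc_local n h) (dd_le_cc n h)
  obtain ⟨𝓒, 𝓓, I, hCw, hDw, hCcard, hDcard, hIcard, hcases⟩ :=
    Ψ.lowerBoundsCriterion hΨB (f := Ψ.eval) (fun _ => rfl) (two_le_rr a) (two_le_ss a)
  rcases hcases with hc1 | hc2
  · -- exit (i): negatives
    have hCm : 4 * ((n + 2) ^ a * (rr a - 1) ^ ss a * ((ss a + 1) * ss a ^ ss a)) * 256 ^ (a + 1) ≤
        (n + 2) ^ (a + 1) := by
      calc 4 * ((n + 2) ^ a * (rr a - 1) ^ ss a * ((ss a + 1) * ss a ^ ss a)) * 256 ^ (a + 1)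
          = (n + 2) ^ a * (4 * ((rr a - 1) ^ ss a * ((ss a + 1) * ss a ^ ss a)) * 256 ^ (a + 1)) := by
            ring
        _ ≤ (n + 2) ^ a * (n + 2) := Nat.mul_le_mul_left _ hT3
        _ = (n + 2) ^ (a + 1) := (pow_succ _ _).symm
    have hnum := numeric_neg n NN t h q Dm a ((n + 2) ^ a * (rr a - 1) ^ ss a) (ss a) hD1 hDm_le
      htD' h4D ht1 htN hhN rfl hdec hCm hD8'
    exact caseNeg_absurd n k t h ((n + 2) ^ a * (rr a - 1) ^ ss a) (ss a) (v0 a) (8 * (a + 1)) Dm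
      (1 / (8 * ((n + 2 : ℕ) : ℝ) ^ (3 + 1))) (by positivity) hh1 hh2 hhk hD1 hh_sq htD hts htN
      (by rw [ss_eq]; exact Nat.lt_succ_self _) (by rw [v0_eq]; omega) Ψ hV2 𝓒 hCw
      (hCcard.trans (Nat.mul_le_mul_right _ hΨsz)) hc1 hnum
  · -- exit (ii): positives
    have hnum := numeric_pos n k a (ss a - 1) hk3 hkw hkn hk16 h4sk hT2 h16
    exact casePos_absurd n k (w0 a) (ss a - 1) ((n + 2) ^ a * (ss a - 1) ^ rr a)
      (1 / (8 * ((n + 2 : ℕ) : ℝ) ^ (3 + 1))) (by positivity) hk3 hkw Ψ hV1 𝓓 I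
      (fun P hP => by rw [hDw P hP, rr_eq]; exact Nat.lt_succ_self _)
      (hDcard.trans (Nat.mul_le_mul_right _ hΨsz)) hIcard hc2 hnum

end Main
end

end Summit.PneNP.PneNP.Theorems.CliqueExtLowerBound.Negative
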